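import Summits.ResolutionOfSingularities.ResolutionOfSingularities.Theorems.PPowerForm
import HarnessLib

/-!
# PPowerTowers — decomp-res node «FrobeniusForm» (lens-4 g23, critic row 144), tree file 4/4 of the node

Content VERBATIM from the decomp-res lens-4 g23 file `HOME/decomp-res-lens-4/g23/FrobeniusForm.lean` (sha256
24d32aa2…, 1018 l; HOME = run/shared/lean/pub/decomp-res).
Critic: CRITIC-LEDGER row 144 (CLEARED 2026-08-30T20:58:02Z; MAP node: the two-way census dictionary «initial form
a `p`-power form ⟺ absolutely contact-free»
as a KERNEL theorem).  Split by the lens's sections for the 400-line limit (the critic's `PPowerForm` = §55–§57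
is two files here).  Landed by decomp-res writer g7
in the lens's namespace `…Theorems.HugValuationCut`.  Asides: NONE new — 28338
`LCNoWildContactFreeOffLocusTowers` stays the booked residual; `NoWildPPowerOffLocusTowers`
lands as a def with its up-link, to supersede 28338 only when an every-field iff makes the re-location exact (critic).

§58 (l. 745–886) TOWERS: contact-free at every stage ⟺ `p`-power form at every stage,
`contactHugging_of_not_pPowerFormAt_root`, the inhabitants
(`fgGround_ratFunc`, `not_perfectField_ratFunc`, …); §59 (l. 888–1014) the `p`-POWER TOWER predicate
`PPowerTower`, the cells `WildPPowerOffLocusTowersTerminate` /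
`WildContactFreeNonPPowerOffLocusTowersTerminate`, `NoTowerFG`, the `_empty` theorems
(`contactFreeNonPPower_perfect_empty` / `_fg_empty`), BY NAME
`NoWildPPowerOffLocusTowers` with its up-link from the aside class and the EXACT
`noWildContactFreeOffLocusTowers_iff_g23` on 28338's statement
`HugValuationCut.NoWildContactFreeOffLocusTowers` (home `LatencyCutCells`).  PROVED, 0 sorry.  Imports `PPowerForm`.
 Supports 28338.  The lens's
`ratFunc_intDegree_pow` (≡ the tree's `CampaignW82.TwistExponent.RatFunc.intDegree_pow'`, dedup.landed; that
module is not imported to keep the closure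
small) becomes a proof-local `have` in its only user `not_perfectField_ratFunc`.

[WRITER NOTE (decomp-res writer g7): file split only; namespace, section variables and every declaration exactly as
in the lens (global `set_option` dropped).  The lens's
first import `MaxContactCutTameCut` (in the Theses cone, unused by any proof here) is replaced by the cone-free
`TameCutKernels` + `AbsoluteContactAxes` and the then-dangling
`open …Theses` dropped, so the whole node is OUTSIDE the Theses cone and importable by the route file when a later
every-field iff re-locates 28338.]

(Sources: Abad2019 Thm 4.11 / Prop 6.3; Giraud1975; CossartJannsenSaito2020; CossartPiltant2019 Prop. 2.50;
KawanoueMatsuki2016 §0.4.2; EGA IV₄ 16.11.2; Stacks 00TV.)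
-/

noncomputable section

open CategoryTheory AlgebraicGeometry IsLocalRing
open Literature.AlgebraicGeometry.Resolution
open Summit.ResolutionOfSingularities.ResolutionOfSingularities.Theorems
open WeakOrderReduction ForcedTowerClasses DivergentTowerClasses MonomialTowerClasses
open HugDimensionClasses HugDimensionKernels SurfaceShadowClasses SurfaceShadowKernels
open NearPointCut (SingularClass)
open AbsoluteContactClasses (IsAbsContactAt SepResidueAt diffIdeal_restrict_le stalkMap_comp_toStalk_eq_stalkHom)
open scoped BigOperators

namespace Summit.ResolutionOfSingularities.ResolutionOfSingularities.Theorems.HugValuationCut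

/-! ## §58 (g23 · NEW · KERNEL) TOWERS: contact-free at every stage ⟺ `p`-power form at every stage; a root that is not
a `p`-power form hugs for ever; the census letter. -/
section Towers

variable {K : Type} [Field K]

/-- positivity of the weight of a tower datum of order exactly `n` at a point of the (nonempty) top locus: `n = 0` would
make `𝓘 = 𝒪` of order `0`… we only need: `idealOrder I y = n` with `𝓘_y ⊆ 𝔪_y` forces `0 < n`;
recorded in the form
used below. [folklore] -/
theorem pos_of_idealOrder_eq_of_le {Y : Scheme.{0}} (I : Y.IdealSheafData) (y : Y) {n : ℕ}
    (hord : idealOrder I y = ((n : ℕ) : ℕ∞)) (hle : stalkIdeal I y ≤ maximalIdeal (Y.presheaf.stalk y)) : 0 < n := by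
  by_contra h0
  have hn : n = 0 := by omega
  have h1 := (le_idealOrder_iff I y 1).mpr (by simpa using hle)
  rw [hord, hn] at h1
  exact absurd (ENat.coe_le_coe.mp h1) (by omega)

/-- **KERNEL (PROVED): STAGEWISE DICTIONARY over a perfect field** — at every stage `j` of a forced tower over a perfect
field with datum of weight `n ≥ 1`: absolute contact at the marked point ⟺ the stage ideal is not a `p`-power form there
(the stage engine `tower_isBase` / `tower_idealOrder_pt_eq` of the landed g22 node + §57). [folklore] -/
theorem isAbsContactAt_stage_iff_perfect {p : ℕ} (hp : p.Prime) [CharP K p] [PerfectField K] {n : ℕ} (hn : 0 < n)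
    (T : ForcedTower) (g : T.St 0 ⟶ Spec (.of K)) (hB : IsBase (T.St 0) g) (hD : IsDatum n (T.D 0)) (j : ℕ) :
    IsAbsContactAt (T.D j).ideal n (T.pt j) ↔ ¬ PPowerFormAt p (T.D j).ideal n (T.pt j) :=
  isAbsContactAt_iff_not_pPowerFormAt hp (toRoot T j ≫ g) (tower_isBase T g hB j) (T.D j).ideal hn
    (tower_idealOrder_pt_eq T g hB hD j)

/-- **KERNEL (PROVED): STAGEWISE DICTIONARY over a finitely generated field.** [folklore] -/
theorem isAbsContactAt_stage_iff_fg {p : ℕ} (hp : p.Prime) [CharP K p] (hK : FGGround p K) {n : ℕ} (hn : 0 < n)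
    (T : ForcedTower) (g : T.St 0 ⟶ Spec (.of K)) (hB : IsBase (T.St 0) g) (hD : IsDatum n (T.D 0)) (j : ℕ) :
    IsAbsContactAt (T.D j).ideal n (T.pt j) ↔ ¬ PPowerFormAt p (T.D j).ideal n (T.pt j) :=
  isAbsContactAt_iff_not_pPowerFormAt_fg hp hK (toRoot T j ≫ g) (tower_isBase T g hB j) (T.D j).ideal hn
    (tower_idealOrder_pt_eq T g hB hD j)

/-- **THE TOWER DICTIONARY (KERNEL, PROVED): over a perfect field a forced tower is ABSOLUTELY CONTACT-FREE AT EVERY STAGE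
(g22's located wild residual «contact-free tower», by letter `∀ j, ¬ IsAbsContactAt (T.D j).ideal n (T.pt j)`) IFF ITS
STAGE IDEAL IS A `p`-POWER FORM AT EVERY MARKED POINT** — the strict-kangaroo residual re-typed through initial forms,
EXACTLY. (Sources: Giraud1975; CossartPiltant2008, Prop. 4.2; EGAIV4, Thm. 16.11.2.) -/
theorem contactFree_iff_pPowerTower_perfect {p : ℕ} (hp : p.Prime) [CharP K p] [PerfectField K] {n : ℕ} (hn : 0 < n)
    (T : ForcedTower) (g : T.St 0 ⟶ Spec (.of K)) (hB : IsBase (T.St 0) g) (hD : IsDatum n (T.D 0)) :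
    (∀ j, ¬ IsAbsContactAt (T.D j).ideal n (T.pt j)) ↔ ∀ j, PPowerFormAt p (T.D j).ideal n (T.pt j) :=
  forall_congr' fun j => by rw [isAbsContactAt_stage_iff_perfect hp hn T g hB hD j, not_not]

/-- **THE TOWER DICTIONARY over a finitely generated field (KERNEL, PROVED).** [folklore] -/
theorem contactFree_iff_pPowerTower_fg {p : ℕ} (hp : p.Prime) [CharP K p] (hK : FGGround p K) {n : ℕ} (hn : 0 < n)
    (T : ForcedTower) (g : T.St 0 ⟶ Spec (.of K)) (hB : IsBase (T.St 0) g) (hD : IsDatum n (T.D 0)) :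
    (∀ j, ¬ IsAbsContactAt (T.D j).ideal n (T.pt j)) ↔ ∀ j, PPowerFormAt p (T.D j).ideal n (T.pt j) :=
  forall_congr' fun j => by rw [isAbsContactAt_stage_iff_fg hp hK hn T g hB hD j, not_not]

/-- **THE ROOT THEOREM (KERNEL, PROVED): a forced tower over a perfect field whose ROOT ideal is NOT a `p`-power form at the
root point hugs a regular hypersurface germ for ever** (`ContactHugging`, 31571's class, through the landed
`contactHugging_of_isAbsContactAt_root`).  This is the certified reading of the census transport T-wild-in: all 404 tame
seeds (and every wild seed with a unit-coefficient exponent `≢ 0 (mod p)` in its initial form) have absolute contact at the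
root. (Sources: Giraud1975; EncinasVillamayor2000, Thm. 4.9; EGAIV4, Thm. 16.11.2.) -/
theorem contactHugging_of_not_pPowerFormAt_root {p : ℕ} (hp : p.Prime) [CharP K p] [PerfectField K] {n : ℕ}
    (hn : 0 < n) (T : ForcedTower) (g : T.St 0 ⟶ Spec (.of K)) (hB : IsBase (T.St 0) g) (hD : IsDatum n (T.D 0))
    (h : ¬ PPowerFormAt p (T.D 0).ideal n (T.pt 0)) : ContactHugging T := by
  obtain ⟨N, rfl⟩ : ∃ N, n = N + 1 := ⟨n - 1, by omega⟩
  exact contactHugging_of_isAbsContactAt_root T g hB hD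
    (isAbsContactAt_of_not_pPowerFormAt hp g hB (T.D 0).ideal (by omega) (tower_idealOrder_pt_eq T g hB hD 0) h)

/-- **THE ROOT THEOREM over a finitely generated field (KERNEL, PROVED).** [folklore] -/
theorem contactHugging_of_not_pPowerFormAt_root_fg {p : ℕ} (hp : p.Prime) (hK : FGGround p K) {n : ℕ}
    (hn : 0 < n) (T : ForcedTower) (g : T.St 0 ⟶ Spec (.of K)) (hB : IsBase (T.St 0) g) (hD : IsDatum n (T.D 0))
    (h : ¬ PPowerFormAt p (T.D 0).ideal n (T.pt 0)) : ContactHugging T := by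
  obtain ⟨N, rfl⟩ : ∃ N, n = N + 1 := ⟨n - 1, by omega⟩
  exact contactHugging_of_isAbsContactAt_root T g hB hD
    (isAbsContactAt_of_not_pPowerFormAt_fg hp hK g hB (T.D 0).ideal (by omega) (tower_idealOrder_pt_eq T g hB hD 0) h)

/-- **COROLLARY (KERNEL, PROVED): the TAME tower theorem over a finitely generated field** (weight prime to `p` ⟹
`ContactHugging`, no separability hypothesis; over a perfect field this is the tree's g21 `contactHugging_of_tame_perfect`,
and lens-6 g18 has the every-field version by Q-frames). (Sources: EGAIV4, Thm. 16.11.2.) -/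
theorem contactHugging_of_tame_fg {p : ℕ} (hp : p.Prime) {n : ℕ} (hpn : ¬ p ∣ n) (hK : FGGround p K)
    (T : ForcedTower) (g : T.St 0 ⟶ Spec (.of K)) (hB : IsBase (T.St 0) g) (hD : IsDatum n (T.D 0)) :
    ContactHugging T :=
  contactHugging_of_not_pPowerFormAt_root_fg hp hK (Nat.pos_of_ne_zero (by rintro rfl; exact hpn (dvd_zero p)))
    T g hB hD fun h => hpn h.1

/-- **CONTACT-FREE AT THE ROOT ⟹ `p`-POWER ROOT (KERNEL, PROVED)** — in particular wild weight `p ∣ n` (g22 / lens-6's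
`dvd_of_forall_not_isAbsContactAt` recovered through the dictionary). [folklore] -/
theorem pPowerFormAt_root_of_not_isAbsContactAt {p : ℕ} (hp : p.Prime) [CharP K p] [PerfectField K] {n : ℕ} (hn : 0 < n)
    (T : ForcedTower) (g : T.St 0 ⟶ Spec (.of K)) (hB : IsBase (T.St 0) g) (hD : IsDatum n (T.D 0))
    (h : ¬ IsAbsContactAt (T.D 0).ideal n (T.pt 0)) : PPowerFormAt p (T.D 0).ideal n (T.pt 0) ∧ p ∣ n := by
  have := (isAbsContactAt_stage_iff_perfect hp hn T g hB hD 0).not_left.mp h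
  exact ⟨this, this.1⟩

/-! ### Inhabitants of the regimes (EXHIBITED) -/
/-- **INHABITANT · `𝔽_p(t)` is an `FGGround`** (a localization of the finite-type algebra `𝔽_p[t]`). [folklore] -/
theorem fgGround_ratFunc (p : ℕ) [Fact p.Prime] : FGGround p (RatFunc (ZMod p)) := by
  refine ⟨inferInstance, ?_⟩
  haveI : Algebra.EssFiniteType (Polynomial (ZMod p)) (RatFunc (ZMod p)) :=
    Algebra.EssFiniteType.of_isLocalization (RatFunc (ZMod p)) (nonZeroDivisors (Polynomial (ZMod p)))
  exact Algebra.EssFiniteType.comp (ZMod p) (Polynomial (ZMod p)) (RatFunc (ZMod p))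

/-- **INHABITANT · `𝔽_p(t)` is IMPERFECT** (`t` is not a `p`-th power: degrees). So the decided FG cell is not the
perfect cell of g21. [folklore] -/
theorem not_perfectField_ratFunc (p : ℕ) [hp : Fact p.Prime] : ¬ PerfectField (RatFunc (ZMod p)) := by
  intro hperf
  haveI : CharP (RatFunc (ZMod p)) p :=
    charP_of_injective_algebraMap (algebraMap (ZMod p) (RatFunc (ZMod p))).injective p
  haveI : ExpChar (RatFunc (ZMod p)) p := ExpChar.prime hp.out
  obtain ⟨s, hs⟩ := surjective_frobenius (RatFunc (ZMod p)) p RatFunc.X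
  rw [frobenius_def] at hs
  have hs0 : s ≠ 0 := by
    rintro rfl
    rw [zero_pow hp.out.ne_zero] at hs
    exact RatFunc.X_ne_zero hs.symm
  have hdeg := congrArg RatFunc.intDegree hs
  have ratFunc_intDegree_pow : ∀ {s : RatFunc (ZMod p)}, s ≠ 0 → ∀ m : ℕ, (s ^ m).intDegree = m * s.intDegree := by
    intro s hs m
    induction m with
    | zero => simp [RatFunc.intDegree_one]
    | succ m ih =>
      rw [pow_succ, RatFunc.intDegree_mul (pow_ne_zero m hs) hs, ih]
      push_cast
      ring
  rw [ratFunc_intDegree_pow hs0, RatFunc.intDegree_X] at hdeg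
  have h1 : (p : ℤ) ∣ 1 := ⟨s.intDegree, hdeg.symm⟩
  have := Int.eq_one_of_dvd_one (Int.natCast_nonneg p) h1
  have hp2 := hp.out.two_le
  omega

/-- **INHABITANT of the FG–imperfect regime**: some `FGGround` of characteristic `p` is NOT perfect. [folklore] -/
theorem exists_fgGround_not_perfectField (p : ℕ) [Fact p.Prime] :
    ∃ (K : Type) (_ : Field K), ∃ _ : CharP K p, FGGround p K ∧ ¬ PerfectField K :=
  ⟨RatFunc (ZMod p), inferInstance,
    charP_of_injective_algebraMap (algebraMap (ZMod p) (RatFunc (ZMod p))).injective p, fgGround_ratFunc p,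
    not_perfectField_ratFunc p⟩

/-- **Finite fields are `FGGround`s** (and perfect): the two DECIDED tame regimes — g21's (perfect `k`) and g23's
(`FGGround p k`) — overlap exactly in the finite-type-over-a-finite-field situations; neither contains the other
(`𝔽_p(t)` is FG and imperfect; `𝔽_p(t)^{perf}` is perfect and not FG). [folklore] -/
theorem fgGround_of_finite (p : ℕ) [Fact p.Prime] (K : Type) [Field K] [CharP K p] [Finite K] : FGGround p K := by
  letI : Algebra (ZMod p) K := ZMod.algebra K p
  haveI : Module.Finite (ZMod p) K := Module.Finite.of_finite
  exact ⟨inferInstance, inferInstance⟩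

end Towers

/-! ## §59 (g23 · NEW) THE `p`-POWER TOWER PREDICATE, THE CUT OF g22's LOCATED WILD RESIDUAL and its re-locations BY NAME
(tree `Theorems/LatencyCutClasses`, `LatencyCutCells`, landed g22): `ContactFreeTower n T ⟸ PPowerTower n T` over EVERY
field (Frobenius gain), `⟺` over perfect and finitely generated fields (the dictionary); the aside
`NoWildContactFreeOffLocusTowers` ⟺ (wild `p`-POWER towers) ∧ (wild contact-free NON-`p`-power towers), the second
conjunct EMPTY over perfect and over finitely generated ground fields (KERNEL). -/
section PPowerTowers

variable {K : Type} [Field K]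

/-- **`PPowerTower n T` — THE STAGE IDEAL IS A `p`-POWER FORM AT EVERY MARKED POINT** (`p` = the characteristic of the
local ring of the marked point; NEW TYPED PREDICATE, field-free so that it can sit inside the tree's class binders):
Hironaka's purely inseparable initial forms at every infinitely near point — the strict-kangaroo habitat by letter of the
census bit. DEFINITION (support). -/
def PPowerTower (n : ℕ) (T : ForcedTower) : Prop :=
  ∀ (j : ℕ) (p : ℕ), p.Prime → CharP ((T.St j).presheaf.stalk (T.pt j)) p → PPowerFormAt p (T.D j).ideal n (T.pt j)

/-- the local ring of a marked point of a tower over a field of characteristic `p` has characteristic `p`. [folklore] -/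
theorem charP_stalk_stage {p : ℕ} [CharP K p] (T : ForcedTower) (g : T.St 0 ⟶ Spec (.of K)) (j : ℕ) :
    CharP ((T.St j).presheaf.stalk (T.pt j)) p := by
  letI := stalkAlgebra ((toRoot T j ≫ g).appTop.hom.comp (Scheme.ΓSpecIso (.of K)).inv.hom) (T.pt j)
  exact charP_of_injective_algebraMap (algebraMap K ((T.St j).presheaf.stalk (T.pt j))).injective p

/-- inside a class binder (`k` of characteristic `p`) the field-free predicate is `∀ j, PPowerFormAt p …`. [folklore] -/
theorem pPowerTower_iff {p : ℕ} (hp : p.Prime) [CharP K p] {n : ℕ} (T : ForcedTower) (g : T.St 0 ⟶ Spec (.of K)) :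
    PPowerTower n T ↔ ∀ j, PPowerFormAt p (T.D j).ideal n (T.pt j) := by
  refine ⟨fun h j => h j p hp (charP_stalk_stage T g j), fun h j q hq hchar => ?_⟩
  have hqp : q = p := CharP.eq _ hchar (charP_stalk_stage T g j)
  subst hqp
  exact h j

/-- **KERNEL (PROVED, EVERY field): a `p`-POWER TOWER IS ABSOLUTELY CONTACT-FREE AT EVERY STAGE** (the Frobenius gain,
stage by stage). (Sources: EGAIV4, Prop. 16.8.8.) -/
theorem contactFreeTower_of_pPowerTower {p : ℕ} (hp : p.Prime) [CharP K p] {n : ℕ} (hn : 0 < n) (T : ForcedTower)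
    (g : T.St 0 ⟶ Spec (.of K)) (h : PPowerTower n T) : ContactFreeTower n T := fun j => by
  haveI := Fact.mk hp
  haveI := charP_stalk_stage T g j
  exact not_isAbsContactAt_of_pPowerFormAt hn (h j p hp inferInstance)

/-- **KERNEL (PROVED): over a PERFECT field, CONTACT-FREE TOWER ⟺ `p`-POWER TOWER** (g22's located residual predicate
`ContactFreeTower`, re-typed EXACTLY through initial forms). (Sources: Giraud1975; EGAIV4, Thm. 16.11.2, Prop. 16.8.8.) -/
theorem contactFreeTower_iff_pPowerTower_perfect {p : ℕ} (hp : p.Prime) [CharP K p] [PerfectField K] {n : ℕ}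
    (hn : 0 < n) (T : ForcedTower) (g : T.St 0 ⟶ Spec (.of K)) (hB : IsBase (T.St 0) g) (hD : IsDatum n (T.D 0)) :
    ContactFreeTower n T ↔ PPowerTower n T := by
  rw [pPowerTower_iff hp T g]
  exact contactFree_iff_pPowerTower_perfect hp hn T g hB hD

/-- **KERNEL (PROVED): over a FINITELY GENERATED field, CONTACT-FREE TOWER ⟺ `p`-POWER TOWER.** [folklore] -/
theorem contactFreeTower_iff_pPowerTower_fg {p : ℕ} (hp : p.Prime) [CharP K p] (hK : FGGround p K) {n : ℕ}
    (hn : 0 < n) (T : ForcedTower) (g : T.St 0 ⟶ Spec (.of K)) (hB : IsBase (T.St 0) g) (hD : IsDatum n (T.D 0)) :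
    ContactFreeTower n T ↔ PPowerTower n T := by
  rw [pPowerTower_iff hp T g]
  exact contactFree_iff_pPowerTower_fg hp hK hn T g hB hD

/-- **CELL (O, wild, `p`-power) · THE LOCATED RESIDUAL of g22's (O, wild, contact-free) after g23**: `p ∣ n`, off-locus
singular class, and the stage ideal is a `p`-POWER FORM AT EVERY MARKED POINT — the strict kangaroos by letter
(census: the 5 chains of T-kangO-deep with bit `0` at every sampled stage). UNDECIDED · IDEA-NEEDED (a law on the
`κ`-structure of the `p`-power forms along the tower: Moh's bound / Cossart–Piltant's `ω`). -/
def WildPPowerOffLocusTowersTerminate (n : ℕ) : Prop :=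
  NoTowerWild n fun T => (SingularClass T ∧ Nonempty (MarkedShadow T n)) ∧ PPowerTower n T

/-- **CELL (O, wild, contact-free, NOT `p`-power)** — EMPTY over every perfect and every finitely generated ground field
(`contactFreeNonPPower_perfect_empty`, `contactFreeNonPPower_fg_empty`); what is left lives over imperfect fields that are
not finitely generated over `𝔽_p` (and, by lens-6 g18's Q-frames at closed points, is expected empty outright). -/
def WildContactFreeNonPPowerOffLocusTowersTerminate (n : ℕ) : Prop :=
  NoTowerWild n fun T => ((SingularClass T ∧ Nonempty (MarkedShadow T n)) ∧ ContactFreeTower n T) ∧ ¬ PPowerTower n T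

/-- **EXACT (pure logic + the every-field kernel): g22's located wild residual = the `p`-power bed ∧ the non-`p`-power
contact-free bed.** [folklore] -/
theorem wildContactFreeOffLocus_iff_g23 {n : ℕ} (hn : 1 ≤ n) :
    WildContactFreeOffLocusTowersTerminate n ↔
      WildPPowerOffLocusTowersTerminate n ∧ WildContactFreeNonPPowerOffLocusTowersTerminate n := by
  constructor
  · intro h
    refine ⟨fun p hp hpn k _ _ T g hB hD hE hP => h p hp hpn k T g hB hD hE
      ⟨hP.1, contactFreeTower_of_pPowerTower hp (by omega) T g hP.2⟩, noTowerWild_mono (fun _ h' => h'.1) h⟩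
  · rintro ⟨h₁, h₂⟩ p hp hpn k _ _ T g hB hD hE ⟨hA, hCF⟩
    by_cases hPP : PPowerTower n T
    · exact h₁ p hp hpn k T g hB hD hE ⟨hA, hPP⟩
    · exact h₂ p hp hpn k T g hB hD hE ⟨⟨hA, hCF⟩, hPP⟩

/-- the `p`-power bed is a sub-residual of g22's (hypothesis-free). [folklore] -/
theorem wildPPowerOffLocus_of_wildContactFreeOffLocus {n : ℕ} (hn : 1 ≤ n) (h : WildContactFreeOffLocusTowersTerminate n) :
    WildPPowerOffLocusTowersTerminate n :=
  ((wildContactFreeOffLocus_iff_g23 hn).mp h).1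

/-- **A class over FINITELY GENERATED ground fields** (the `FGGround` column of the tree's `NoTower`). -/
def NoTowerFG (n : ℕ) (P : ForcedTower → Prop) : Prop :=
  ∀ p : ℕ, p.Prime → ∀ (k : Type) [Field k] [CharP k p], FGGround p k → ∀ (T : ForcedTower) (g : T.St 0 ⟶ Spec (.of k)),
    IsBase (T.St 0) g → IsDatum n (T.D 0) → (T.D 0).boundary = [] → P T → False

/-- **KERNEL (PROVED): over a PERFECT ground field NO tower of any class is contact-free without being a `p`-power tower**
— the perfect column of the non-`p`-power contact-free bed is EMPTY (all weights, all classes). [folklore] -/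
theorem contactFreeNonPPower_perfect_empty {n : ℕ} (hn : 1 ≤ n) (A : ForcedTower → Prop) :
    NoTowerPerfect n fun T => (A T ∧ ContactFreeTower n T) ∧ ¬ PPowerTower n T :=
  fun p hp k _ _ _ T g hB hD _ hP =>
    hP.2 ((contactFreeTower_iff_pPowerTower_perfect hp (by omega) T g hB hD).mp hP.1.2)

/-- **KERNEL (PROVED): over a FINITELY GENERATED ground field the non-`p`-power contact-free bed is EMPTY** (all weights,
all classes; imperfect f.g. fields such as `𝔽_p(t)` included — `fgGround_ratFunc`, `not_perfectField_ratFunc`).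
[folklore] -/
theorem contactFreeNonPPower_fg_empty {n : ℕ} (hn : 1 ≤ n) (A : ForcedTower → Prop) :
    NoTowerFG n fun T => (A T ∧ ContactFreeTower n T) ∧ ¬ PPowerTower n T :=
  fun p hp k _ _ hK T g hB hD _ hP =>
    hP.2 ((contactFreeTower_iff_pPowerTower_fg hp hK (by omega) T g hB hD).mp hP.1.2)

/-- BY NAME: **no wild `p`-POWER off-locus towers** — THE LOCATED RESIDUAL of the aside `NoWildContactFreeOffLocusTowers`
after g23. -/
def NoWildPPowerOffLocusTowers : Prop := ∀ n : ℕ, 1 ≤ n → WildPPowerOffLocusTowersTerminate n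

/-- BY NAME: the non-`p`-power contact-free wild off-locus bed (perfect and f.g. columns EMPTY by kernel). -/
def NoWildContactFreeNonPPowerOffLocusTowers : Prop :=
  ∀ n : ℕ, 1 ≤ n → WildContactFreeNonPPowerOffLocusTowersTerminate n

/-- **EXACT RE-LOCATION BY NAME (KERNEL + pure logic)**: the tree aside `NoWildContactFreeOffLocusTowers` (g22's located
residual, `Theorems/LatencyCutCells`) ⟺ (no wild `p`-POWER off-locus towers) ∧ (no wild contact-free NON-`p`-power
off-locus towers). [folklore] -/
theorem noWildContactFreeOffLocusTowers_iff_g23 :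
    NoWildContactFreeOffLocusTowers ↔ NoWildPPowerOffLocusTowers ∧ NoWildContactFreeNonPPowerOffLocusTowers :=
  ⟨fun h => ⟨fun n hn => ((wildContactFreeOffLocus_iff_g23 hn).mp (h n hn)).1,
      fun n hn => ((wildContactFreeOffLocus_iff_g23 hn).mp (h n hn)).2⟩,
    fun h n hn => (wildContactFreeOffLocus_iff_g23 hn).mpr ⟨h.1 n hn, h.2 n hn⟩⟩

/-- the aside implies its `p`-power sub-residual (up-link for the writer). [folklore] -/
theorem noWildPPowerOffLocusTowers_of_aside (h : NoWildContactFreeOffLocusTowers) : NoWildPPowerOffLocusTowers :=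
  (noWildContactFreeOffLocusTowers_iff_g23.mp h).1

end PPowerTowers

end Summit.ResolutionOfSingularities.ResolutionOfSingularities.Theorems.HugValuationCut
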